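import Literature.NumberTheory.Rogawski1990.KottwitzSignPlaceReadings
import Literature.NumberTheory.Automorphic.Liu2021.Def412AdmissibleIffParity
import Literature.NumberTheory.QuadraticForms.LandherrHermitianPlanes
import HarnessLib

/-!
# Kottwitz signs, VII: the PRODUCT FORMULA `∏_v e_v((γ₀)_v) · ∏_W e_W(γ₀ ⊗ 1) = 1` for a rational split-singular `γ₀` — Hilbert reciprocity
# (Rogawski 1990, §4.1 (4.1.2) p. 40; §14.5 p. 239; Kottwitz 1983, 1986; O'Meara 71:18)

Topic `NumberTheory/Rogawski1990`; namespace `Literature.NumberTheory.Rogawski1990`.  THEOREMS ONLY (no definition, no named fact, no instance,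
no notation, no `sorry`).  Cell `pub/hodgecm-mathlib`, ENGINE T1 (crux H413 = `stmt-HodgeConjecture-24833`), row O7 «singular semisimple classes»,
«KOTTWITZ SIGNS» W19-4 (F0P3a-ref1 R1-162c; O7 OWNER WORD #24 (A), #26 (1)(c)(e)); sequel of ★ `KottwitzSignPlaceReadings`.  HC_CM is proved only
modulo the printed citations until rung 0 closes; this file discharges none of them — W19-4 is IN-HOUSE (no new citation).

## The mathematics

For `γ₀ ∈ U(H)(L⁺)` rational split-singular non-central with diagonal frame `ᵗ(σP) H P = diag(d₀, d₁, d₂)` (★ `exists_diagonal_frame`), the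
finite signs read `e_v((γ₀)_v) = −1 ↔ (L ⊗ L⁺_v)²` with `diag(d₀,d₁) ⊗ 1` is anisotropic (★ `kottwitzSignLocal_toAdelic_eq_neg_one_iff_not_isIsotropic`)
and the archimedean signs `e_W(γ₀ ⊗ 1) = −1 ↔ 0 < Re σ_W(d₀ d₁)` (★ `kottwitzSignAt_cmRationalToArch_eq_neg_one_iff`).  Hilbert's reciprocity
law for the symbol `(δ², −d₀d₁)` — in the tree ★ `LemD1OfPlace.even_ncard_not_isIsotropic_add_ncard_pos` («the anisotropic finite places plus the
definite real places are EVEN in number») — therefore gives `e_𝐀(γ₀ ⊗ 1) = e_∞ · ∏ᶠ_v e_v = (−1)^{even} = 1`.  This is Kottwitz's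
`∏_v e(G_{γ₀, v}) = 1` for the `L⁺`-group `G_{γ₀} = U(W_a) × U(1)` [Kottwitz1983], the parity half of (4.1.2) ∕ §14.5 p. 239.

* `finprod_kottwitzSignLocal_toAdelic_eq` — `∏ᶠ_v e_v((γ₀)_v) = (−1)^{#{v : anisotropic}}` (the support is the finite anisotropic set, ★
  `LemD1OfPlace.finite_setOf_not_isIsotropic`), **`eventually_kottwitzSignLocal_toAdelic_eq_one`** (`e_v((γ₀)_v) = 1` for almost all `v` — the
  `hw1` input of the weighted Euler products);
* `kottwitzSignArch_cmRationalToArch_eq` — `e_∞(γ₀ ⊗ 1) = (−1)^{#{W : 0 < Re σ_W(d₀d₁)}}`, and `ncard_complexPlace_pos_eq_ncard_realPlace_pos`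
  (the complex places of `L` ↔ the real places of `L⁺`, ★ `IsCMField.card_infinitePlace_eq_card_infinitePlace` + ★ `comap_surjective`);
* **`kottwitzSignAdelic_toAdelic_eq_one`** — W19-4: `kottwitzSignAdelic L 3 H (toAdelic γ₀) = 1` for every rational split-singular non-central `γ₀`,
  and `kottwitzSignWeight_mk_toAdelic_eq_one` (the weight form).

## References
* [Rogawski1990] J. D. Rogawski, *Automorphic Representations of Unitary Groups in Three Variables*, Ann. of Math. Stud. 123 (1990), §4.1 (4.1.2)
  p. 40; §14.5 p. 239.
* [Kottwitz1983] R. E. Kottwitz, *Sign changes in harmonic analysis on reductive groups*, Trans. AMS 278 (1983), 289–297.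
* [Kottwitz1986] R. E. Kottwitz, *Stable trace formula: elliptic singular terms*, Math. Ann. 275 (1986), §9.
* [Omeara1963] O. T. O'Meara, *Introduction to Quadratic Forms* (1963), §71 Thm. 71:18 (Hilbert reciprocity).
-/

set_option autoImplicit false

noncomputable section

open NumberField NumberField.InfinitePlace IsDedekindDomain Matrix
open scoped MatrixGroups

namespace Literature.NumberTheory.Rogawski1990

open Literature.NumberTheory.Automorphic
open Literature.AlgebraicGeometry.ShimuraVarieties (unitaryGroup hermForm)
open Literature.NumberTheory.Automorphic.UnitaryGroup (finSum)

variable {L : Type} [Field L] [NumberField L] [IsCMField L] {H : Matrix (Fin 3) (Fin 3) L}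

/-! ## §1 Book-keeping: products of signs -/

/-- A `±1`-valued function with finite «`−1`-set» `A`: `∏ᶠ_v f v = (−1)^{#A}`. [cite: Omeara1963, §71 Thm. 71:18] -/
private theorem finprod_eq_neg_one_pow_ncard {ι : Type*} (f : ι → ℤˣ) (A : Set ι) (hA : A.Finite) (hf : ∀ i, f i = -1 ↔ i ∈ A)
    (hf1 : ∀ i, f i = 1 ∨ f i = -1) : ∏ᶠ i, f i = (-1) ^ A.ncard := by
  classical
  have hsupp : Function.mulSupport f ⊆ hA.toFinset := by
    intro i hi
    rw [Set.Finite.coe_toFinset]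
    rcases hf1 i with h | h
    · exact absurd h hi
    · exact (hf i).1 h
  rw [finprod_eq_prod_of_mulSupport_subset f hsupp, Set.ncard_eq_toFinset_card A hA]
  have : ∀ i ∈ hA.toFinset, f i = -1 := fun i hi => (hf i).2 (by simpa using hi)
  rw [Finset.prod_congr rfl this, Finset.prod_const]
  rfl

/-- A `±1`-valued function on a finite type: `∏_i f i = (−1)^{#{i : f i = −1}}`. [cite: Omeara1963, §71 Thm. 71:18] -/
private theorem prod_eq_neg_one_pow_card {ι : Type*} [Fintype ι] (f : ι → ℤˣ) (p : ι → Prop) [DecidablePred p] (hf : ∀ i, f i = -1 ↔ p i)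
    (hf1 : ∀ i, f i = 1 ∨ f i = -1) : ∏ i, f i = (-1) ^ (Finset.univ.filter p).card := by
  have h : ∀ i, f i = if p i then -1 else 1 := fun i => by
    rcases hf1 i with h1 | h1
    · rw [h1, if_neg (fun hp => absurd ((hf i).2 hp) (by rw [h1]; decide))]
    · rw [h1, if_pos ((hf i).1 h1)]
  simp_rw [h]
  rw [Finset.prod_ite, Finset.prod_const, Finset.prod_const_one, mul_one]
  rfl

/-! ## §2 The complex places of `L` are the real places of `L⁺` -/

variable (L) in
open scoped Classical in
/-- **The complex places `W` of the CM field `L` with `0 < Re σ_W(t)` are equinumerous with the (real) places `w` of `L⁺` with `0 < w(t)`**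
(`t ∈ L⁺`): `W ↦ W|_{L⁺}` is a bijection `InfinitePlace L → InfinitePlace L⁺` (★ `comap_surjective` and the equal cardinalities ★
`IsCMField.card_infinitePlace_eq_card_infinitePlace`), every place of `L` is complex and every place of `L⁺` is real.
[cite: Rogawski1990, §3.8 Prop. 3.8.1 (d) p. 30] -/
theorem card_complexPlace_pos_eq_ncard_realPlace_pos (t : maximalRealSubfield L) :
    (Finset.univ.filter (fun W : {w : InfinitePlace L // IsComplex w} => 0 < (W.1.embedding (t : L)).re)).card =
      {w : InfinitePlace (maximalRealSubfield L) | ∃ hw : w.IsReal, 0 < InfinitePlace.embedding_of_isReal hw t}.ncard := by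
  classical
  -- the restriction map is a bijection
  set r : InfinitePlace L → InfinitePlace (maximalRealSubfield L) := fun W => W.comap (algebraMap (maximalRealSubfield L) L) with hr
  have hsurj : Function.Surjective r := NumberField.InfinitePlace.comap_surjective
  have hbij : Function.Bijective r := by
    rw [Fintype.bijective_iff_surjective_and_card]
    exact ⟨hsurj, (IsCMField.card_infinitePlace_eq_card_infinitePlace L).symm⟩
  -- the value of the real embedding of `r W` at `t`
  have hval : ∀ W : InfinitePlace L, ∀ hw : (r W).IsReal, InfinitePlace.embedding_of_isReal hw t = (W.embedding (t : L)).re := by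
    intro W hw
    have hrW : r W = InfinitePlace.mk (W.embedding.comp (algebraMap (maximalRealSubfield L) L)) := by
      rw [← InfinitePlace.comap_mk, InfinitePlace.mk_embedding]
    have happ := InfinitePlace.embedding_of_isReal_apply hw t
    rw [congrArg InfinitePlace.embedding hrW] at happ
    rcases InfinitePlace.embedding_mk_eq (W.embedding.comp (algebraMap (maximalRealSubfield L) L)) with h' | h'
    · rw [h', RingHom.comp_apply] at happ
      have hre := congrArg Complex.re happ
      rw [Complex.ofReal_re] at hre
      exact hre
    · rw [h', ComplexEmbedding.conjugate_coe_eq, RingHom.comp_apply] at happ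
      have hre := congrArg Complex.re happ
      rw [Complex.ofReal_re, Complex.conj_re] at hre
      exact hre
  rw [Set.ncard_eq_toFinset_card', Set.toFinset_setOf]
  refine Finset.card_bij (fun W _ => r W.1) (fun W hW => ?_) (fun W₁ hW₁ W₂ hW₂ h => ?_) (fun w hw => ?_)
  · simp only [Finset.mem_filter, Finset.mem_univ, true_and] at hW ⊢
    refine ⟨IsTotallyReal.isReal _, ?_⟩
    rw [hval]
    exact hW
  · exact Subtype.ext (hbij.1 h)
  · simp only [Finset.mem_filter, Finset.mem_univ, true_and] at hw ⊢
    obtain ⟨hw, hpos⟩ := hw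
    obtain ⟨W, hW⟩ := hsurj w
    refine ⟨⟨W, IsTotallyComplex.isComplex W⟩, ?_, hW⟩
    have hv := hval W (hW ▸ hw)
    subst hW
    rw [← hv]
    exact hpos

/-! ## §3 The product formula -/

/-- `cmConjRingHom` is an involution. [folklore] -/
private theorem cmConjRingHom_cmConjRingHom'' (x : L) : cmConjRingHom L (cmConjRingHom L x) = x := by
  rw [cmConjRingHom_apply, cmConjRingHom_apply, IsCMField.complexConj_apply_apply]

/-- **W19-4 — THE PRODUCT FORMULA `e_𝐀(γ₀ ⊗ 1) = 1` for a RATIONAL split-singular non-central `γ₀ ∈ U(H)(L⁺)`** (`H ∈ M₃(L)` hermitian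
non-degenerate over the CM field `L`): the anisotropic finite places of the eigenplane and its definite real places are even in number
(Hilbert reciprocity for `(δ², −d₀d₁)`, ★ `LemD1OfPlace.even_ncard_not_isIsotropic_add_ncard_pos`), so the adelic Kottwitz sign
`e_∞(γ₀ ⊗ 1) · ∏ᶠ_v e_v((γ₀)_v)` of ★ `kottwitzSignAdelic` is `1`.  This is Kottwitz's `∏_v e(G_{γ₀,v}) = 1` for `G_{γ₀} = U(W_a) × U(1)`.
[cite: Rogawski1990, §4.1 (4.1.2) p. 40; §14.5 p. 239] [cite: Kottwitz1983, §1] [cite: Omeara1963, §71 Thm. 71:18] -/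
theorem kottwitzSignAdelic_toAdelic_eq_one (hH : (H.map (cmConjRingHom L))ᵀ = H) (hdet : H.det ≠ 0)
    (γ₀ : (UnitaryGroup.cmDatum L 3 H).Rational) {α β : L} (hαβ : α ≠ β)
    (hγ : ((((γ₀ : unitaryGroup (cmConjRingHom L) H).val : GL (Fin 3) L).val : Matrix (Fin 3) (Fin 3) L) - α • 1) *
      ((((γ₀ : unitaryGroup (cmConjRingHom L) H).val : GL (Fin 3) L).val : Matrix (Fin 3) (Fin 3) L) - β • 1) = 0)
    (hα : (((γ₀ : unitaryGroup (cmConjRingHom L) H).val : GL (Fin 3) L).val : Matrix (Fin 3) (Fin 3) L) ≠ α • 1)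
    (hβ : (((γ₀ : unitaryGroup (cmConjRingHom L) H).val : GL (Fin 3) L).val : Matrix (Fin 3) (Fin 3) L) ≠ β • 1) :
    kottwitzSignAdelic L 3 H ((UnitaryGroup.cmDatum L 3 H).toAdelic γ₀) = 1 := by
  classical
  -- the diagonal frame
  have h2 : (1 : L) + 1 ≠ 0 := by norm_num
  obtain ⟨a, b, P, d, hab, -, -, hd, hd0, hP, hγP⟩ :=
    exists_diagonal_frame (cmConjRingHom L) (cmConjRingHom_cmConjRingHom'' (L := L)) h2 H hH hdet
      (γ₀ : unitaryGroup (cmConjRingHom L) H) hαβ hγ hα hβ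
  have hab' : a ≠ b := by
    rcases hab with ⟨rfl, rfl⟩ | ⟨rfl, rfl⟩
    · exact hαβ
    · exact hαβ.symm
  have habu : IsUnit (a - b) := isUnit_iff_ne_zero.2 (sub_ne_zero.2 hab')
  -- a purely imaginary `δ ≠ 0`
  obtain ⟨x, hx⟩ : ∃ x : L, IsCMField.complexConj L x ≠ x := by
    by_contra! h
    exact IsCMField.complexConj_ne_one L (AlgEquiv.ext h)
  set δ : L := x - IsCMField.complexConj L x with hδdef
  have hcδ : IsCMField.complexConj L δ = -δ := by rw [hδdef, map_sub, IsCMField.complexConj_apply_apply, neg_sub]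
  have hδ : δ ≠ 0 := fun h0 => hx (sub_eq_zero.1 h0).symm
  -- the plane's diagonal `dJ = (d₀, d₁)`, real and non-degenerate
  have hdc : ∀ i, IsCMField.complexConj L (d i) = d i := fun i => by rw [← cmConjRingHom_apply]; exact hd i
  let t : Fin 2 → maximalRealSubfield L := fun i => ⟨d (Fin.castSucc i), (IsCMField.complexConj_eq_self_iff (K := L) _).1 (hdc _)⟩
  have hJ : Matrix.diagonal ![d 0, d 1] = (Matrix.diagonal t).map (algebraMap (maximalRealSubfield L) L) := by
    rw [Matrix.diagonal_map (map_zero _)]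
    congr 1
    funext i; fin_cases i <;> rfl
  have ht : ∀ i, t i ≠ 0 := fun i h => hd0 _ (congrArg Subtype.val h)
  have hJh : ((Matrix.diagonal ![d 0, d 1]).map (IsCMField.complexConj L))ᵀ = Matrix.diagonal ![d 0, d 1] := by
    rw [Matrix.diagonal_map (map_zero _), Matrix.diagonal_transpose]
    congr 1
    funext i; fin_cases i
    · exact hdc 0
    · exact hdc 1
  have hJdet : (Matrix.diagonal ![d 0, d 1]).det ≠ 0 := by
    rw [Matrix.det_diagonal, Fin.prod_univ_two]
    exact mul_ne_zero (hd0 0) (hd0 1)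
  let dd : maximalRealSubfield L :=
    ⟨δ * δ, (IsCMField.complexConj_eq_self_iff (K := L) (δ * δ)).1 (by rw [map_mul, hcδ, neg_mul_neg])⟩
  have hdd : δ * δ = algebraMap (maximalRealSubfield L) L dd := rfl
  have hdneg : ∀ (w : InfinitePlace (maximalRealSubfield L)) (hw : w.IsReal), InfinitePlace.embedding_of_isReal hw dd < 0 :=
    fun w hw => Liu2021.embedding_of_isReal_lt_zero_of_coe_eq_mul_self hcδ hδ rfl w hw
  -- Hilbert reciprocity: anisotropic finite places + definite real places are EVEN
  have hpar := Liu2021.LemD1OfPlace.even_ncard_not_isIsotropic_add_ncard_pos L (IsCMField.complexConj L) hcδ hδ t hJ hJh hJdet hdd ht hdneg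
  set A : Set (HeightOneSpectrum (𝓞 ↥(maximalRealSubfield L))) := {v | ¬ Liu2021.LemD1.IsIsotropic
    (Liu2021.LemD1OfPlace.standingData L v (IsCMField.complexConj L) 2 (Matrix.diagonal ![d 0, d 1]) hcδ hδ le_rfl hJh hJdet)} with hA
  have hAfin : A.Finite := Liu2021.LemD1OfPlace.finite_setOf_not_isIsotropic L (IsCMField.complexConj L) hcδ hδ t hJ hJh hJdet hdd ht
  -- the finite factor
  have hfin : ∏ᶠ v : HeightOneSpectrum (𝓞 ↥(maximalRealSubfield L)),
      kottwitzSignLocal L 3 H v (ConjClasses.mk ((UnitaryGroup.cmDatum L 3 H).toLocal v ((UnitaryGroup.cmDatum L 3 H).toAdelic γ₀))) =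
      (-1) ^ A.ncard :=
    finprod_eq_neg_one_pow_ncard _ A hAfin
      (fun v => kottwitzSignLocal_toAdelic_eq_neg_one_iff_not_isIsotropic v γ₀ habu hd0 hP hγP hcδ hδ hJh hJdet)
      (fun v => by unfold kottwitzSignLocal; exact kottwitzSign_eq_one_or_eq_neg_one _)
  -- the archimedean factor
  have ht01 : ((t 0 * t 1 : maximalRealSubfield L) : L) = d 0 * d 1 := rfl
  have harch : kottwitzSignArch L 3 H (ConjClasses.mk (UnitaryGroup.archPart (↥(maximalRealSubfield L)) L (IsCMField.complexConj L) 3 H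
      ((UnitaryGroup.cmDatum L 3 H).toAdelic γ₀))) =
      (-1) ^ {w : InfinitePlace (maximalRealSubfield L) | ∃ hw : w.IsReal, 0 < InfinitePlace.embedding_of_isReal hw (t 0 * t 1)}.ncard := by
    rw [archPart_cmDatum_toAdelic, kottwitzSignArch_mk,
      prod_eq_neg_one_pow_card _ (fun W : {w : InfinitePlace L // IsComplex w} => 0 < (W.1.embedding ((t 0 * t 1 : maximalRealSubfield L) : L)).re)
        (fun W => by rw [ht01]; exact kottwitzSignAt_cmRationalToArch_eq_neg_one_iff W γ₀ habu hd hd0 hP hγP)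
        (fun W => by unfold kottwitzSignAt; exact kottwitzSign_eq_one_or_eq_neg_one _),
      card_complexPlace_pos_eq_ncard_realPlace_pos L (t 0 * t 1)]
  -- assemble (`ℤˣ` powers with natural exponents elaborate through `Int.instUnitsPow`: use `uzpow_add` and `u * u = 1`)
  unfold kottwitzSignAdelic
  rw [harch, hfin, ← uzpow_add, add_comm]
  obtain ⟨k, hk⟩ := hpar
  rw [hk, uzpow_add]
  exact Int.units_mul_self _

/-- **The weight form of W19-4**: `kottwitzSignWeight [γ₀ ⊗ 1] = 1` at the BASE POINT of the adelic stable class of a rational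
split-singular non-central `γ₀`. [cite: Rogawski1990, §4.1 (4.1.2) p. 40; §14.5 p. 239] [cite: Kottwitz1983, §1] -/
theorem kottwitzSignWeight_mk_toAdelic_eq_one (hH : (H.map (cmConjRingHom L))ᵀ = H) (hdet : H.det ≠ 0)
    (γ₀ : (UnitaryGroup.cmDatum L 3 H).Rational) {α β : L} (hαβ : α ≠ β)
    (hγ : ((((γ₀ : unitaryGroup (cmConjRingHom L) H).val : GL (Fin 3) L).val : Matrix (Fin 3) (Fin 3) L) - α • 1) *
      ((((γ₀ : unitaryGroup (cmConjRingHom L) H).val : GL (Fin 3) L).val : Matrix (Fin 3) (Fin 3) L) - β • 1) = 0)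
    (hα : (((γ₀ : unitaryGroup (cmConjRingHom L) H).val : GL (Fin 3) L).val : Matrix (Fin 3) (Fin 3) L) ≠ α • 1)
    (hβ : (((γ₀ : unitaryGroup (cmConjRingHom L) H).val : GL (Fin 3) L).val : Matrix (Fin 3) (Fin 3) L) ≠ β • 1) :
    kottwitzSignWeight L 3 H (ConjClasses.mk ((UnitaryGroup.cmDatum L 3 H).toAdelic γ₀)) = 1 := by
  rw [kottwitzSignWeight_mk, kottwitzSignAdelic_toAdelic_eq_one hH hdet γ₀ hαβ hγ hα hβ, Units.val_one, Int.cast_one]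

/-- **`e_v((γ₀)_v) = 1` FOR ALMOST ALL `v`** (the `hw1` input of the weighted Euler products): the exceptional set is the finite set of
anisotropic places of the eigenplane (★ `LemD1OfPlace.finite_setOf_not_isIsotropic`). [cite: Rogawski1990, §4.1 (4.1.2) p. 40; §14.5 p. 239] -/
theorem eventually_kottwitzSignLocal_toAdelic_eq_one (hH : (H.map (cmConjRingHom L))ᵀ = H) (hdet : H.det ≠ 0)
    (γ₀ : (UnitaryGroup.cmDatum L 3 H).Rational) {α β : L} (hαβ : α ≠ β)
    (hγ : ((((γ₀ : unitaryGroup (cmConjRingHom L) H).val : GL (Fin 3) L).val : Matrix (Fin 3) (Fin 3) L) - α • 1) *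
      ((((γ₀ : unitaryGroup (cmConjRingHom L) H).val : GL (Fin 3) L).val : Matrix (Fin 3) (Fin 3) L) - β • 1) = 0)
    (hα : (((γ₀ : unitaryGroup (cmConjRingHom L) H).val : GL (Fin 3) L).val : Matrix (Fin 3) (Fin 3) L) ≠ α • 1)
    (hβ : (((γ₀ : unitaryGroup (cmConjRingHom L) H).val : GL (Fin 3) L).val : Matrix (Fin 3) (Fin 3) L) ≠ β • 1) :
    ∀ᶠ v : HeightOneSpectrum (𝓞 ↥(maximalRealSubfield L)) in Filter.cofinite,
      kottwitzSignLocal L 3 H v (ConjClasses.mk ((UnitaryGroup.cmDatum L 3 H).toLocal v ((UnitaryGroup.cmDatum L 3 H).toAdelic γ₀))) = 1 := by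
  classical
  have h2 : (1 : L) + 1 ≠ 0 := by norm_num
  obtain ⟨a, b, P, d, hab, -, -, hd, hd0, hP, hγP⟩ :=
    exists_diagonal_frame (cmConjRingHom L) (cmConjRingHom_cmConjRingHom'' (L := L)) h2 H hH hdet
      (γ₀ : unitaryGroup (cmConjRingHom L) H) hαβ hγ hα hβ
  have hab' : a ≠ b := by
    rcases hab with ⟨rfl, rfl⟩ | ⟨rfl, rfl⟩
    · exact hαβ
    · exact hαβ.symm
  have habu : IsUnit (a - b) := isUnit_iff_ne_zero.2 (sub_ne_zero.2 hab')
  obtain ⟨x, hx⟩ : ∃ x : L, IsCMField.complexConj L x ≠ x := by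
    by_contra! h
    exact IsCMField.complexConj_ne_one L (AlgEquiv.ext h)
  set δ : L := x - IsCMField.complexConj L x with hδdef
  have hcδ : IsCMField.complexConj L δ = -δ := by rw [hδdef, map_sub, IsCMField.complexConj_apply_apply, neg_sub]
  have hδ : δ ≠ 0 := fun h0 => hx (sub_eq_zero.1 h0).symm
  have hdc : ∀ i, IsCMField.complexConj L (d i) = d i := fun i => by rw [← cmConjRingHom_apply]; exact hd i
  let t : Fin 2 → maximalRealSubfield L := fun i => ⟨d (Fin.castSucc i), (IsCMField.complexConj_eq_self_iff (K := L) _).1 (hdc _)⟩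
  have hJ : Matrix.diagonal ![d 0, d 1] = (Matrix.diagonal t).map (algebraMap (maximalRealSubfield L) L) := by
    rw [Matrix.diagonal_map (map_zero _)]
    congr 1
    funext i; fin_cases i <;> rfl
  have ht : ∀ i, t i ≠ 0 := fun i h => hd0 _ (congrArg Subtype.val h)
  have hJh : ((Matrix.diagonal ![d 0, d 1]).map (IsCMField.complexConj L))ᵀ = Matrix.diagonal ![d 0, d 1] := by
    rw [Matrix.diagonal_map (map_zero _), Matrix.diagonal_transpose]
    congr 1
    funext i; fin_cases i
    · exact hdc 0
    · exact hdc 1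
  have hJdet : (Matrix.diagonal ![d 0, d 1]).det ≠ 0 := by
    rw [Matrix.det_diagonal, Fin.prod_univ_two]
    exact mul_ne_zero (hd0 0) (hd0 1)
  let dd : maximalRealSubfield L :=
    ⟨δ * δ, (IsCMField.complexConj_eq_self_iff (K := L) (δ * δ)).1 (by rw [map_mul, hcδ, neg_mul_neg])⟩
  have hdd : δ * δ = algebraMap (maximalRealSubfield L) L dd := rfl
  have hAfin := Liu2021.LemD1OfPlace.finite_setOf_not_isIsotropic L (IsCMField.complexConj L) hcδ hδ t hJ hJh hJdet hdd ht
  refine (hAfin.eventually_cofinite_notMem).mono fun v hv => ?_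
  have h1 : kottwitzSignLocal L 3 H v (ConjClasses.mk ((UnitaryGroup.cmDatum L 3 H).toLocal v ((UnitaryGroup.cmDatum L 3 H).toAdelic γ₀))) = 1 ∨
      kottwitzSignLocal L 3 H v (ConjClasses.mk ((UnitaryGroup.cmDatum L 3 H).toLocal v ((UnitaryGroup.cmDatum L 3 H).toAdelic γ₀))) = -1 := by
    unfold kottwitzSignLocal; exact kottwitzSign_eq_one_or_eq_neg_one _
  rcases h1 with h1 | h1
  · exact h1
  · exfalso
    exact hv ((kottwitzSignLocal_toAdelic_eq_neg_one_iff_not_isIsotropic v γ₀ habu hd0 hP hγP hcδ hδ hJh hJdet).1 h1)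

end Literature.NumberTheory.Rogawski1990

end
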